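import Summits.QuantumFields.BalabanUV.Beta.EriceFlowEnclosureB12AsPrintedPointwiseFadingSignFamily
import Summits.QuantumFields.BalabanUV.Beta.B12AsPrintedRowD4Junction

/-!
# Beta / EriceFlowEnclosureB12AsPrintedPointwiseFace — WHAT (0.31) FORCES POINTWISE, part 9: THROUGH THE FACE g_k = 0.  [I] prints ((2.13) p. 268) that the interaction term
# *"vanishes at g_k = 0"* — typed as `Definitions.d213` — so on the face g_k = 0 of the coupling domain EVERY β_{k+1} IS HISTORY-FREE (row-D4 owner's `B12AsPrintedRowD4Junction.beta_eq_of_lastZero`,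
# from d213 + d13∕d120∕d120split∕d122): one number φ_k per scale, the value of β_{k+1} at zero last coupling (the «one-loop ∕ zeroth-order» coefficient of the cell's `OneLoopSplit` reading).
# The face is therefore a UNIVERSAL COMPARISON POINT: with the cell's (AF-1) letter `BetaDerivClause.LastVarLipschitzAtZero S.β C γ_U` (|β_{k+1}(g_{≤k}) − β_{k+1}(g_{<k}, 0)| ≤ C g_k) a box history p
# and a run history r at the same scale satisfy |β_{k+1}(p) − β_{k+1}(r)| ≤ C(p_k + r_k) WHATEVER THEIR EARLIER COUPLINGS — no Markov letter, no injectivity, no uniqueness, no history moduli (parts 1–8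
# compared p with a run history of the SAME last coupling and paid for the earlier couplings).  Theorem 2 on the lattice K = k + 1 reads the last window of its tuned run: β ln L ≤ β_{k+1}(r_{≤k}) ≤ β′ ln L
# with r_k ≤ g, g as small as we please ⟹ (uniform reading) **`face_bounds_of_uniformTheorem2_AF1`**: β ln L ≤ φ_k ≤ β′ ln L at EVERY scale — (0.31)'s constants ARE (AF-0) bounds on the face
# sequence — and **`betaAFH_of_uniformTheorem2_AF1`**: `BetaLowerH (β ln L − Cδ) δ ∧ BetaUpperH (β′ ln L + Cδ) δ`, `BetaAFH S.β` — parts 2∕6's END with the Markov ∕ fading-memory letters REPLACED by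
# (AF-1) alone; (typed reading) **`face_nonneg_of_theorem2_AF1`**: φ_k ≥ 0 at every scale and **`betaLowerH_neg_of_theorem2_AF1`**: β_{k+1} ≥ −Cδ on ]0, δ]^{k+1} — part 8's O(δ) without moduli — both
# SHARP by part 8a's ramp family (φ_1 = 0, β_2 < 0 off the face, (AF-1) with C = 1 on ]0, ½]: §4).  Converse in the tree: `FlowStep.betaLowerH_of_split` ((AF-0) ≥ 2b on the face + (AF-1) ⟹ AF letter)
# (β-flow team, prover 2 = lower ∕ positivity side, unit `b2b-balaban-beta-bflow-p2`, gen 44; ROW AP-I × row D4's face letter × row I1∕an4's (AF-1))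

HONEST FRAMING (page 1 of everything the β sub-cell writes): discharging `BetaPertH` makes Bałaban's UV stability UNCONDITIONAL — a
real constructive-QFT result; it is NOT the continuum limit and NOT the Clay problem.  HONEST DEPENDENCY (cell reorg 2026-08-19,
verbatim): «continuum YM on T⁴ ⇐ BetaPertH ∧ nine spine estimates (0/9 proved); BetaPertH ⇐ (D1) ∧ (D4) ∧ CAP+tail; G-an2-4 gates
asym, D1 and NE2/3/4.»  THIS MODULE DISCHARGES NOTHING: bookkeeping from the NAMED FIELDS of the statement-exact typing `B12BetaAsPrinted` of [I] = T. Bałaban, Commun. Math.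
Phys. **109** (1987) [Balaban1987RG1] (`Definitions` — incl. the PRINTED (2.13) remark `d213` and (1.22) `d122` —; `Theorem2Statement`, STATED WITHOUT PROOF p. 259, a HYPOTHESIS, or its
g-uniform cpl-form `hTu`, a READING), prover 1's binder `hrg` (or (U) with b′γ_U² < 1) and the cell's letter (AF-1) `LastVarLipschitzAtZero` (p. 264 «C^∞ … on [0, γ]» made quantitative and
k-uniform — UNPRINTED uniformity, GAPS G-adv2-3).  Nothing of Bałaban's (1.22) is asserted; the ramp family of §4 is OURS.

WHAT THIS FILE PROVES (0 sorry, 0 def): §1 `face_eq` (history-free face value), `lastWindow_of_run`, `face_window_of_run`; §2 **`face_bounds_of_uniformTheorem2_AF1`**,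
**`betaAFH_of_uniformTheorem2_AF1`**, `betaAFH_of_uniformTheorem2_AF1'` (`hrg` from (U)); §3 **`face_nonneg_of_theorem2_AF1`**, **`betaLowerH_neg_of_theorem2_AF1`**; §4 `lastVarLipschitzAtZero_ramp`,
`face_ramp_eq_zero` (sharpness of §3 by part 8a's family).
NOT CLAIMED: the value or sign of Bałaban's one-loop coefficients; any letter for Bałaban's β; which reading print intends; Theorem 2; `BetaPertH`; continuum; Clay.
-/

namespace Summit.QuantumFields.BalabanUV.Beta.EriceFlowEnclosureB12AsPrintedPointwiseFace

open Literature.MathematicalPhysics.QuantumFieldTheory.Balaban1983to89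
open Literature.MathematicalPhysics.QuantumFieldTheory.Balaban1983to89.B12BetaAsPrinted
open Literature.MathematicalPhysics.QuantumFieldTheory.Balaban1983to89.FlowStep (HBeta prefixOf Box mem_box box_mono RGEqH BetaUpperH BetaLowerH
  BetaSignH BetaAFH histBox_eq_box)
open Literature.MathematicalPhysics.QuantumFieldTheory.Balaban1983to89.BetaDerivClause (LastVarLipschitzAtZero)
open Summit.QuantumFields.BalabanUV.Beta.EriceFlowEnclosureB12AsPrintedUpper (tunedRuns_of_theorem2Statement)
open Summit.QuantumFields.BalabanUV.Beta.EriceFlowEnclosureB12AsPrintedTunedUpper (hrg_of_betaUpperH prefixOf_mem_box_of_inInterval)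
open Summit.QuantumFields.BalabanUV.Beta.B12AsPrintedRowD4Junction (beta_eq_of_lastZero)
open Summit.QuantumFields.BalabanUV.Beta.EriceFlowEnclosureB12AsPrintedPointwiseFadingSignFamily (beta_of_ne_one beta_one)

noncomputable section

variable {S : Setting}

/-! ## §1 The face value is history-free; the last window of a tuned run read at the face -/

/-- **THE FACE VALUE IS HISTORY-FREE** ((2.13)'s printed remark, typed `Definitions.d213`, through (1.3)∕(1.20)∕(1.22) — row-D4 owner's `beta_eq_of_lastZero`): for two histories p, q in a box
]0, γ_U]^{k+1} with γ_U ≤ γ, β_{k+1}(p_{<k}, 0) = β_{k+1}(q_{<k}, 0). [cite: Balaban1987RG1, (2.13)–(2.14) p.268 («vanishes at g_k = 0») with (1.20)–(1.22) p.264] -/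
theorem face_eq (hD : Definitions S) {γU : ℝ} (hγU : γU ≤ S.γ) {k : ℕ} {p q : Fin (k + 1) → ℝ} (hp : p ∈ Box γU k) (hq : q ∈ Box γU k) :
    S.β k (Function.update p (Fin.last k) 0) = S.β k (Function.update q (Fin.last k) 0) := by
  have hγ : 0 ≤ S.γ := le_trans (le_trans ((mem_box.mp hp) (Fin.last k)).1.le ((mem_box.mp hp) (Fin.last k)).2) hγU
  have h0 : (0 : ℝ) ∈ Set.Icc (0 : ℝ) S.γ := ⟨le_rfl, hγ⟩
  exact beta_eq_of_lastZero hD (update_mem_histDom (box_mono hγU k hp) h0) (update_mem_histDom (box_mono hγU k hq) h0)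
    (by simp) (by simp)

/-- **THE LAST WINDOW OF A RUN.**  A positive run r of length k + 1 obeying (0.20) with `Step.Discrete031 b b′ (k+1) (r_{k+1}) r`: its last β-value satisfies b ≤ β_{k+1}(r_{≤k}) ≤ b′
((0.31) at scale k minus (0.20) at scale k). [cite: Balaban1987RG1, (0.20) p.256 and (0.31) p.259] -/
theorem lastWindow_of_run {b b' : ℝ} {k : ℕ} {r : ℕ → ℝ} (hrg : RGEqH (k + 1) S.β r) (hD : Step.Discrete031 b b' (k + 1) (r (k + 1)) r) :
    b ≤ S.β k (prefixOf r k) ∧ S.β k (prefixOf r k) ≤ b' := by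
  have e := hrg k (Nat.lt_succ_self k)
  have h := hD k (Nat.le_succ k)
  push_cast at h
  constructor <;> nlinarith [h.1, h.2, e]

/-- **THE LAST WINDOW READ AT THE FACE.**  If moreover the run's prefix lies in ]0, γ_U]^{k+1} and (AF-1) `LastVarLipschitzAtZero S.β C γ_U` holds, then the face value at scale k obeys
`b − C·r_k ≤ β_{k+1}(r_{<k}, 0) ≤ b′ + C·r_k`. [cite: Balaban1987RG1, (0.31) p.259 with §1 p.264 and (2.13) p.268] -/
theorem face_window_of_run {b b' C γU : ℝ} {k : ℕ} {r : ℕ → ℝ} (hrg : RGEqH (k + 1) S.β r) (hD : Step.Discrete031 b b' (k + 1) (r (k + 1)) r)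
    (hbox : prefixOf r k ∈ Box γU k) (hAF1 : LastVarLipschitzAtZero S.β C γU) :
    b - C * r k ≤ S.β k (Function.update (prefixOf r k) (Fin.last k) 0) ∧ S.β k (Function.update (prefixOf r k) (Fin.last k) 0) ≤ b' + C * r k := by
  obtain ⟨hlo, hhi⟩ := lastWindow_of_run hrg hD
  have h := hAF1 k (prefixOf r k) ((histBox_eq_box γU k).symm ▸ hbox)
  simp only [FlowStep.prefixOf_apply, Fin.val_last] at h
  have h' := abs_le.mp h
  constructor <;> linarith [h'.1, h'.2]

/-! ## §2 The uniform reading: (0.31)'s constants bound the face sequence; the AF letter from (AF-1) alone -/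

/-- Along a run with the (0.31) window at positive lower constant, every coupling is below the endpoint: r_k ≤ r_K. [cite: Balaban1987RG1, (0.31) p.259] -/
theorem le_end_of_discrete031 {b b' : ℝ} {K : ℕ} {r : ℕ → ℝ} (hb : 0 ≤ b) (hpos : ∀ i, i ≤ K → 0 < r i)
    (hD : Step.Discrete031 b b' K (r K) r) {k : ℕ} (hk : k ≤ K) : r k ≤ r K := by
  have h := (hD k hk).1
  have hkK : (k : ℝ) ≤ K := by exact_mod_cast hk
  have hd : (0 : ℝ) ≤ (K : ℝ) - k := by linarith
  have hle : 1 / (r K) ^ 2 ≤ 1 / (r k) ^ 2 := by nlinarith [mul_nonneg hb hd]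
  exact (pow_le_pow_iff_left₀ (hpos k hk).le (hpos K le_rfl).le two_ne_zero).mp
    ((one_div_le_one_div (pow_pos (hpos K le_rfl) 2) (pow_pos (hpos k hk) 2)).mp hle)

/-- **(0.31) WITH g-UNIFORM CONSTANTS BOUNDS THE FACE SEQUENCE.**  The g-uniform cpl-form `hTu` of Theorem 2 (prover 1's `theorem2Statement_of_letters` produces exactly it), the printed
`Definitions`, L > 1, prover 1's binder `hrg` on ]0, γ_U] (γ_U ≤ γ) and (AF-1) `LastVarLipschitzAtZero S.β C γ_U` ⟹ there are 0 < β ≤ β′ with `β ln L ≤ β_{k+1}(q_{<k}, 0) ≤ β′ ln L` for EVERY scale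
k and EVERY q ∈ ]0, γ_U]^{k+1} (the face value does not depend on q): Theorem 2 on the lattice K = k + 1 with endpoint g gives the window [β ln L, β′ ln L] at the run history (last
coupling ≤ g), (AF-1) moves it to the face at cost Cg, and g → 0.  NO Markov letter, NO injectivity, NO uniqueness, NO history moduli. [cite: Balaban1987RG1, Thm 2 (0.31) p.259 with (2.13) p.268 and §1 p.264] -/
theorem face_bounds_of_uniformTheorem2_AF1 (hD : Definitions S) (hL1 : 1 < S.L)
    (hTu : ∀ m : ℕ, ∃ γ₀ : ℝ, 0 < γ₀ ∧ ∀ γ : ℝ, 0 < γ → γ ≤ γ₀ → ∃ g₁ : ℝ, 0 < g₁ ∧ ∃ β β' : ℝ, 0 < β ∧ β ≤ β' ∧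
      ∀ g : ℝ, 0 < g → g ≤ g₁ → ∀ K : ℕ, ∃ g₀ : ℝ, Step.InInterval γ K (S.cpl ⟨K, m, g₀⟩) ∧ S.cpl ⟨K, m, g₀⟩ K = g ∧
        Step.Discrete031 (β * Real.log S.L) (β' * Real.log S.L) K g (S.cpl ⟨K, m, g₀⟩))
    (m : ℕ) {γU C : ℝ} (hγU : 0 < γU) (hγUS : γU ≤ S.γ) (hC : 0 ≤ C)
    (hrg : ∀ P : B12.RunParams, Step.InInterval γU P.K (S.cpl P) → RGEqH P.K S.β (S.cpl P)) (hAF1 : LastVarLipschitzAtZero S.β C γU) :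
    ∃ β β' : ℝ, 0 < β ∧ β ≤ β' ∧ ∀ (k : ℕ) (q : Fin (k + 1) → ℝ), q ∈ Box γU k →
      β * Real.log S.L ≤ S.β k (Function.update q (Fin.last k) 0) ∧ S.β k (Function.update q (Fin.last k) 0) ≤ β' * Real.log S.L := by
  have hlog : 0 < Real.log (S.L : ℝ) := Real.log_pos (by exact_mod_cast hL1)
  obtain ⟨γ₀, hγ₀, hγ⟩ := hTu m
  obtain ⟨g₁, hg₁, β, β', hβ, hββ', hg⟩ := hγ (min γ₀ γU) (lt_min hγ₀ hγU) (min_le_left _ _)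
  refine ⟨β, β', hβ, hββ', fun k q hq => ?_⟩
  -- for every small endpoint g the face value is within Cg of the window [β ln L, β′ ln L]
  have key : ∀ g : ℝ, 0 < g → g ≤ g₁ →
      β * Real.log S.L - C * g ≤ S.β k (Function.update q (Fin.last k) 0) ∧
        S.β k (Function.update q (Fin.last k) 0) ≤ β' * Real.log S.L + C * g := by
    intro g hgpos hgle
    obtain ⟨g₀, hI, hend, hDisc⟩ := hg g hgpos hgle (k + 1)
    have hIU : Step.InInterval γU (k + 1) (S.cpl ⟨k + 1, m, g₀⟩) := fun i hi => ⟨(hI i hi).1, (hI i hi).2.trans (min_le_right _ _)⟩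
    have hrgr : RGEqH (k + 1) S.β (S.cpl ⟨k + 1, m, g₀⟩) := hrg ⟨k + 1, m, g₀⟩ hIU
    have hboxr : prefixOf (S.cpl ⟨k + 1, m, g₀⟩) k ∈ Box γU k := prefixOf_mem_box_of_inInterval hIU (Nat.le_succ k)
    have hDisc' : Step.Discrete031 (β * Real.log S.L) (β' * Real.log S.L) (k + 1) (S.cpl ⟨k + 1, m, g₀⟩ (k + 1))
        (S.cpl ⟨k + 1, m, g₀⟩) := by rw [hend]; exact hDisc
    obtain ⟨hlo, hhi⟩ := face_window_of_run hrgr hDisc' hboxr hAF1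
    rw [face_eq hD hγUS hboxr hq] at hlo hhi
    have hrk : S.cpl ⟨k + 1, m, g₀⟩ k ≤ g := by
      have h := le_end_of_discrete031 (mul_pos hβ hlog).le (fun i hi => (hI i hi).1) hDisc' (Nat.le_succ k)
      rwa [hend] at h
    have hCr : C * S.cpl ⟨k + 1, m, g₀⟩ k ≤ C * g := mul_le_mul_of_nonneg_left hrk hC
    exact ⟨by linarith, by linarith⟩
  have hsmall : ∀ ε : ℝ, 0 < ε → ∃ g : ℝ, 0 < g ∧ g ≤ g₁ ∧ C * g ≤ ε := fun ε hε =>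
    ⟨min g₁ (ε / (C + 1)), lt_min hg₁ (by positivity), min_le_left _ _, by
      calc C * min g₁ (ε / (C + 1)) ≤ C * (ε / (C + 1)) := mul_le_mul_of_nonneg_left (min_le_right _ _) hC
        _ ≤ ε := by rw [mul_div_assoc', div_le_iff₀ (by positivity)]; nlinarith⟩
  constructor
  · refine le_of_forall_pos_le_add fun ε hε => ?_
    obtain ⟨g, hg0, hgle, hCg⟩ := hsmall ε hε
    linarith [(key g hg0 hgle).1]
  · refine le_of_forall_pos_le_add fun ε hε => ?_
    obtain ⟨g, hg0, hgle, hCg⟩ := hsmall ε hε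
    linarith [(key g hg0 hgle).2]

/-- **THE AF LETTER FROM (AF-1) ALONE.**  Under the hypotheses of `face_bounds_of_uniformTheorem2_AF1`: for every box ]0, δ]^{k+1} with δ ≤ γ_U, `β ln L − Cδ ≤ β_{k+1} ≤ β′ ln L + Cδ` — hence
`BetaAFH S.β`.  Parts 2 (#59b: Markov + injectivity) and 6 (#60b: `HistLipschitz` + `FadingMemory`) with their structural letters REPLACED by the cell's (AF-1); the face g_k = 0 does the
comparison. [cite: Balaban1987RG1, Thm 2 (0.31) p.259 with (2.13) p.268 and §1 p.264] -/
theorem betaAFH_of_uniformTheorem2_AF1 (hD : Definitions S) (hL1 : 1 < S.L)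
    (hTu : ∀ m : ℕ, ∃ γ₀ : ℝ, 0 < γ₀ ∧ ∀ γ : ℝ, 0 < γ → γ ≤ γ₀ → ∃ g₁ : ℝ, 0 < g₁ ∧ ∃ β β' : ℝ, 0 < β ∧ β ≤ β' ∧
      ∀ g : ℝ, 0 < g → g ≤ g₁ → ∀ K : ℕ, ∃ g₀ : ℝ, Step.InInterval γ K (S.cpl ⟨K, m, g₀⟩) ∧ S.cpl ⟨K, m, g₀⟩ K = g ∧
        Step.Discrete031 (β * Real.log S.L) (β' * Real.log S.L) K g (S.cpl ⟨K, m, g₀⟩))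
    (m : ℕ) {γU C : ℝ} (hγU : 0 < γU) (hγUS : γU ≤ S.γ) (hC : 0 ≤ C)
    (hrg : ∀ P : B12.RunParams, Step.InInterval γU P.K (S.cpl P) → RGEqH P.K S.β (S.cpl P)) (hAF1 : LastVarLipschitzAtZero S.β C γU) :
    (∃ β β' : ℝ, 0 < β ∧ β ≤ β' ∧ ∀ δ : ℝ, 0 < δ → δ ≤ γU →
      BetaLowerH (β * Real.log S.L - C * δ) δ S.β ∧ BetaUpperH (β' * Real.log S.L + C * δ) δ S.β) ∧ BetaAFH S.β := by
  have hlog : 0 < Real.log (S.L : ℝ) := Real.log_pos (by exact_mod_cast hL1)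
  obtain ⟨β, β', hβ, hββ', hface⟩ := face_bounds_of_uniformTheorem2_AF1 hD hL1 hTu m hγU hγUS hC hrg hAF1
  have hbox : ∀ δ : ℝ, 0 < δ → δ ≤ γU → BetaLowerH (β * Real.log S.L - C * δ) δ S.β ∧ BetaUpperH (β' * Real.log S.L + C * δ) δ S.β := by
    intro δ hδ hδU
    have hstep : ∀ (k : ℕ) (p : Fin (k + 1) → ℝ), p ∈ Box δ k →
        |S.β k p - S.β k (Function.update p (Fin.last k) 0)| ≤ C * δ ∧
          β * Real.log S.L ≤ S.β k (Function.update p (Fin.last k) 0) ∧ S.β k (Function.update p (Fin.last k) 0) ≤ β' * Real.log S.L := by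
      intro k p hp
      have hpU : p ∈ Box γU k := box_mono hδU k hp
      have h1 := hAF1 k p ((histBox_eq_box γU k).symm ▸ hpU)
      exact ⟨h1.trans (mul_le_mul_of_nonneg_left ((mem_box.mp hp) (Fin.last k)).2 hC), hface k p hpU⟩
    refine ⟨fun k p hp => ?_, fun k p hp => ?_⟩
    · obtain ⟨h1, h2, -⟩ := hstep k p hp
      linarith [(abs_le.mp h1).1]
    · obtain ⟨h1, -, h3⟩ := hstep k p hp
      linarith [(abs_le.mp h1).2]
  refine ⟨⟨β, β', hβ, hββ', hbox⟩, ?_⟩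
  -- the AF letter on the box δ := min γ_U (β ln L / (2C + 1))
  have hbl : 0 < β * Real.log S.L := mul_pos hβ hlog
  set δ : ℝ := min γU (β * Real.log S.L / (2 * C + 1)) with hδ
  have hδpos : 0 < δ := lt_min hγU (by positivity)
  have hCδ : C * δ ≤ β * Real.log S.L / 2 := by
    have h1 : C * δ ≤ C * (β * Real.log S.L / (2 * C + 1)) := mul_le_mul_of_nonneg_left (min_le_right _ _) hC
    have h2 : C * (β * Real.log S.L / (2 * C + 1)) ≤ β * Real.log S.L / 2 := by
      rw [mul_div_assoc', div_le_iff₀ (by positivity : (0 : ℝ) < 2 * C + 1)]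
      have e : β * Real.log S.L / 2 * (2 * C + 1) = C * (β * Real.log S.L) + β * Real.log S.L / 2 := by ring
      rw [e]; linarith
    exact h1.trans h2
  refine ⟨δ, hδpos, β * Real.log S.L / 2, by positivity, fun k p hp => ?_⟩
  have h := (hbox δ hδpos (min_le_left _ _)).1 k p hp
  linarith

/-- The same END with prover 1's binder `hrg` DISCHARGED from the upper letter (U) `β_{k+1} ≤ b′` on ]0, γ_U]^{k+1} with b′γ_U² < 1 (`…TunedUpper.hrg_of_betaUpperH`): inputs = `Definitions`,
L > 1, `hTu`, (U), (AF-1). [cite: Balaban1987RG1, Thm 2 (0.31) p.259 with (2.13) p.268 and §1 p.264] -/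
theorem betaAFH_of_uniformTheorem2_AF1' (hD : Definitions S) (hL1 : 1 < S.L)
    (hTu : ∀ m : ℕ, ∃ γ₀ : ℝ, 0 < γ₀ ∧ ∀ γ : ℝ, 0 < γ → γ ≤ γ₀ → ∃ g₁ : ℝ, 0 < g₁ ∧ ∃ β β' : ℝ, 0 < β ∧ β ≤ β' ∧
      ∀ g : ℝ, 0 < g → g ≤ g₁ → ∀ K : ℕ, ∃ g₀ : ℝ, Step.InInterval γ K (S.cpl ⟨K, m, g₀⟩) ∧ S.cpl ⟨K, m, g₀⟩ K = g ∧
        Step.Discrete031 (β * Real.log S.L) (β' * Real.log S.L) K g (S.cpl ⟨K, m, g₀⟩))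
    {γU b' C : ℝ} (hγU : 0 < γU) (hγUS : γU ≤ S.γ) (hC : 0 ≤ C) (hub : BetaUpperH b' γU S.β) (hsmall : b' * γU ^ 2 < 1)
    (hAF1 : LastVarLipschitzAtZero S.β C γU) : BetaAFH S.β :=
  (betaAFH_of_uniformTheorem2_AF1 hD hL1 hTu 0 hγU hγUS hC (hrg_of_betaUpperH hD hγU hub hsmall) hAF1).2

/-! ## §3 The typed reading: the face sequence is ≥ 0 and β ≥ −Cδ on the boxes — no moduli -/

/-- **THE TYPED THEOREM 2 FORCES THE SIGN OF THE FACE SEQUENCE.**  `Theorem2Statement S hL` AS TYPED (per-endpoint constants), the printed `Definitions`, prover 1's binder `hrg` on ]0, γ_U]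
(γ_U ≤ γ) and (AF-1) ⟹ `0 ≤ β_{k+1}(q_{<k}, 0)` for every scale k and every q ∈ ]0, γ_U]^{k+1} (Theorem 2 on the lattice k + 1 at endpoint g: the face value is ≥ B₁(g) ln L − Cg > −Cg, and g → 0).
SHARP: part 8a's ramp family has face value 0 at scale 1 with Theorem 2 as typed (§4). [cite: Balaban1987RG1, Thm 2 (0.31) p.259 with (2.13) p.268 and §1 p.264] -/
theorem face_nonneg_of_theorem2_AF1 {hL : Odd S.L ∧ 1 < S.L} (hT : Theorem2Statement S hL) (hD : Definitions S) (m : ℕ)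
    {γU C : ℝ} (hγU : 0 < γU) (hγUS : γU ≤ S.γ) (hC : 0 ≤ C)
    (hrg : ∀ P : B12.RunParams, Step.InInterval γU P.K (S.cpl P) → RGEqH P.K S.β (S.cpl P)) (hAF1 : LastVarLipschitzAtZero S.β C γU)
    (k : ℕ) {q : Fin (k + 1) → ℝ} (hq : q ∈ Box γU k) : 0 ≤ S.β k (Function.update q (Fin.last k) 0) := by
  have hlog : 0 < Real.log (S.L : ℝ) := Real.log_pos (by exact_mod_cast hL.2)
  obtain ⟨γ₀, hγ₀, hγ⟩ := tunedRuns_of_theorem2Statement hT m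
  obtain ⟨g₁, hg₁, hg⟩ := hγ (min γ₀ γU) (lt_min hγ₀ hγU) (min_le_left _ _)
  -- for every small endpoint g: face value ≥ −Cg
  have key : ∀ g : ℝ, 0 < g → g ≤ g₁ → -(C * g) ≤ S.β k (Function.update q (Fin.last k) 0) := by
    intro g hgpos hgle
    obtain ⟨β, β', hβ, -, hK⟩ := hg g hgpos hgle
    obtain ⟨g₀, hI, hend, hDisc⟩ := hK (k + 1)
    have hIU : Step.InInterval γU (k + 1) (S.cpl ⟨k + 1, m, g₀⟩) := fun i hi => ⟨(hI i hi).1, (hI i hi).2.trans (min_le_right _ _)⟩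
    have hrgr : RGEqH (k + 1) S.β (S.cpl ⟨k + 1, m, g₀⟩) := hrg ⟨k + 1, m, g₀⟩ hIU
    have hboxr : prefixOf (S.cpl ⟨k + 1, m, g₀⟩) k ∈ Box γU k := prefixOf_mem_box_of_inInterval hIU (Nat.le_succ k)
    have hDisc' : Step.Discrete031 (β * Real.log S.L) (β' * Real.log S.L) (k + 1) (S.cpl ⟨k + 1, m, g₀⟩ (k + 1))
        (S.cpl ⟨k + 1, m, g₀⟩) := by rw [hend]; exact hDisc
    have hrk : S.cpl ⟨k + 1, m, g₀⟩ k ≤ g := by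
      have h := le_end_of_discrete031 (mul_pos hβ hlog).le (fun i hi => (hI i hi).1) hDisc' (Nat.le_succ k)
      rwa [hend] at h
    obtain ⟨hlo, -⟩ := face_window_of_run hrgr hDisc' hboxr hAF1
    rw [face_eq hD hγUS hboxr hq] at hlo
    have hCr : C * S.cpl ⟨k + 1, m, g₀⟩ k ≤ C * g := mul_le_mul_of_nonneg_left hrk hC
    nlinarith [mul_pos hβ hlog]
  refine le_of_forall_pos_le_add fun ε hε => ?_
  have hgε : 0 < min g₁ (ε / (C + 1)) := lt_min hg₁ (by positivity)
  have h := key _ hgε (min_le_left _ _)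
  have hCg : C * min g₁ (ε / (C + 1)) ≤ ε := by
    calc C * min g₁ (ε / (C + 1)) ≤ C * (ε / (C + 1)) := mul_le_mul_of_nonneg_left (min_le_right _ _) hC
      _ ≤ ε := by rw [mul_div_assoc', div_le_iff₀ (by positivity)]; nlinarith
  linarith

/-- **THE TYPED THEOREM 2 FORCES β ≥ −Cδ ON THE BOXES — WITHOUT HISTORY MODULI.**  Same hypotheses: for every δ ≤ γ_U and every p ∈ ]0, δ]^{k+1}, `−C·δ ≤ β_{k+1}(p)` (face value ≥ 0 by
`face_nonneg_of_theorem2_AF1`, and (AF-1)).  Part 8's `negPart_of_theorem2_fadingMemory` with `HistLipschitz` + `FadingMemory` REPLACED by (AF-1); SHARP up to the constant by part 8a's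
ramp family (β_2(δ, δ∕3) = −δ²∕9, (AF-1) with C = 2δ on ]0, δ]). [cite: Balaban1987RG1, Thm 2 (0.31) p.259 with (2.13) p.268 and §1 p.264] -/
theorem betaLowerH_neg_of_theorem2_AF1 {hL : Odd S.L ∧ 1 < S.L} (hT : Theorem2Statement S hL) (hD : Definitions S) (m : ℕ)
    {γU C : ℝ} (hγU : 0 < γU) (hγUS : γU ≤ S.γ) (hC : 0 ≤ C)
    (hrg : ∀ P : B12.RunParams, Step.InInterval γU P.K (S.cpl P) → RGEqH P.K S.β (S.cpl P)) (hAF1 : LastVarLipschitzAtZero S.β C γU)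
    {δ : ℝ} (hδU : δ ≤ γU) : BetaLowerH (-(C * δ)) δ S.β := by
  intro k p hp
  have hpU : p ∈ Box γU k := box_mono hδU k hp
  have h1 := (abs_le.mp (hAF1 k p ((histBox_eq_box γU k).symm ▸ hpU))).1
  have h2 := face_nonneg_of_theorem2_AF1 hT hD m hγU hγUS hC hrg hAF1 k hpU
  have h3 : C * p (Fin.last k) ≤ C * δ := mul_le_mul_of_nonneg_left ((mem_box.mp hp) (Fin.last k)).2 hC
  linarith

/-! ## §4 Sharpness: part 8a's ramp family carries (AF-1) and has face value 0 -/

section Ramp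

variable (hβ : ∀ (k : ℕ) (p : Fin (k + 1) → ℝ), S.β k p = if k = 1 then p (Fin.last k) * (2 * p (Fin.last k) - p 0) else 1)
include hβ

/-- The ramp family satisfies the cell's (AF-1) on ]0, γ] with constant 2γ: |β_2(g₀, g₁) − β_2(g₀, 0)| = |g₁(2g₁ − g₀)| ≤ 2γ·g₁; the other scales are constant. [folklore] -/
theorem lastVarLipschitzAtZero_ramp {γ : ℝ} (hγ : 0 ≤ γ) : LastVarLipschitzAtZero S.β (2 * γ) γ := by
  intro k p hp
  by_cases hk : k = 1
  · subst hk
    have hp0 := hp 0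
    have hp1 := hp (Fin.last 1)
    rw [hβ, hβ, if_pos rfl, if_pos rfl, Function.update_self, Function.update_of_ne (by decide : (0 : Fin (1 + 1)) ≠ Fin.last 1)]
    rw [zero_mul, sub_zero, abs_mul, abs_of_pos hp1.1, mul_comm]
    exact mul_le_mul_of_nonneg_right (abs_le.mpr ⟨by linarith [hp0.2, hp1.1], by linarith [hp1.2, hp0.1]⟩) hp1.1.le
  · rw [beta_of_ne_one hβ hk, beta_of_ne_one hβ hk, sub_self, abs_zero]
    exact mul_nonneg (by linarith) (hp (Fin.last k)).1.le

/-- … and its face value at scale 1 is 0 (so `face_nonneg_of_theorem2_AF1` is sharp: part 8a proved THEOREM 2 AS TYPED for every setting carrying the family, and ¬`BetaSignH`). [folklore] -/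
theorem face_ramp_eq_zero (q : Fin (1 + 1) → ℝ) : S.β 1 (Function.update q (Fin.last 1) 0) = 0 := by
  rw [hβ, if_pos rfl, Function.update_self, zero_mul]

end Ramp

end

end Summit.QuantumFields.BalabanUV.Beta.EriceFlowEnclosureB12AsPrintedPointwiseFace
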